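import Summits.CriticalPhenomena.PercolationContinuityZ3.Theorems.PercNearOneGluingNoHeavyLowerTailSahiCombMixMixedThree
import Summits.CriticalPhenomena.PercolationContinuityZ3.Theorems.PercNearOneGluingNoHeavyLowerTailSahiCombMixFour

/-!
# The comb (tensor-Bernstein) hierarchy for Sahi's `E_k`, LI: MIXED steps over FOUR events — the ASSEMBLY from cell interfaces (conditional), the two-slot cells,
# transport; decision-list quadruples modulo the cells

Support file of the one-cut programme (crux `NoHeavyLowerTail`, stmt-CriticalPhenomena-4575; cell `prim-masterthm`, seat P3, gen 9;
`run/shared/lean/prim/prim-masterthm/prim-masterthm-p3/HIERARCHY.md` §17(h),(i)).  The mixed analogue of `…SahiCombMixFour` (gen 8's conditional assembly of comb H-MIX(4)):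
members of the ∩-closed family of a mixed family `orAndCoord U e G₁ G₂` are generic cells `mixCoord e P Q` whose lower event `P` is `∅` as soon as an AND-member is involved
(`biInter_orAndCoord_eq_mixCoord`), so gen 8's two-, three- and four-slot machinery applies verbatim.
* `CombCanonThreeSlotMixedCells k`, `CombFourSingletonMixedCells` — the two cell interfaces (for ALL selector pairs; the pure patterns are already theorems:
  `SahiCombMix.combCanonThreeSlotCells_all` / `combFourSingletonCells` for OR, `SahiCombHereditary.combPos_sahiE_ind_inter_coordChain` for AND; the genuinely mixed ones
  — 49 canonical cells, law-level census kit j120893/j121647 clean, q = 1 LP certificates kit j121646 — are to be lifted in gen 10).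
* **`combHereditary_orAndCoord_four_of_cells`** — GIVEN the two interfaces: for every quadruple `U` of increasing events ignoring `e` with `CombHereditary U` and all
  selectors, `orAndCoord U e G₁ G₂` is `CombHereditary` (irredundant reduction; `m = 2` by the generic two-slot cell `combPos_two_mixCoord` with `P = ∅` allowed; `m = 3`
  dispatcher through `Irredundant.canon_three_four`; `m = 4` singleton slots).
* **`combHereditary_grow₂_four_of_cells`**, **`combHereditary_decisionList_four_of_cells`** — hence (modulo the cells) every quadruple of common-order monotone decision
  lists is comb-positive at every order.
HONEST FRAMING: conditional on the two interfaces; nothing here asserts (M⁺-k) or `C_k` for `k ≥ 3`. [this work]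
-/

noncomputable section

open scoped Classical

namespace Summit.CriticalPhenomena.PercolationContinuityZ3.Theorems

open Finset Function
open Literature.Combinatorics.Sahi2008
open Literature.Probability.Percolation (DeterminedBy determinedBy_iff determinedBy_univ)
open Literature.Probability.Percolation.BHK2006 (ind_le_one ind_inter)
open Literature.Probability.Percolation.DecisionTree (ind ind_of_mem ind_of_not_mem ind_nonneg)
open SahiComb
open SahiCombDisjunct (orCoord)
open SahiCombHereditary (CombHereditary andCoord)
open SahiMixture (Irredundant canonK)

variable {ι : Type} [Fintype ι]

namespace SahiCombMix

/-! ### Members of the ∩-closed family of a mixed family are generic cells -/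

/-- The lower event of the member over `L`: `∅` if `L` contains an AND-member (`¬G₁ i ∧ G₂ i`), else `⋂_{i∈L} U_i`. [this work] -/
def lowerEv {n : ℕ} (U : Fin n → Set (Set ι)) (G₁ G₂ : Fin n → Bool) (L : Finset (Fin n)) : Set (Set ι) :=
  if ∀ i ∈ L, G₁ i = true ∨ G₂ i = false then ⋂ i ∈ L, U i else ∅

omit [Fintype ι] in
/-- **`⋂_{i∈L} orAndCoord U e G₁ G₂ i = mixCoord e (lowerEv U G₁ G₂ L) (⋂_{i∈L, ¬G₁ i} U_i)`.** [this work] -/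
theorem biInter_orAndCoord_eq_mixCoord {n : ℕ} (U : Fin n → Set (Set ι)) (e : ι) (G₁ G₂ : Fin n → Bool) (L : Finset (Fin n)) :
    (⋂ i ∈ L, orAndCoord U e G₁ G₂ i) = mixCoord e (lowerEv U G₁ G₂ L) (⋂ i ∈ L.filter (fun i => G₁ i = false), U i) := by
  ext ω
  simp only [Set.mem_iInter, mem_mixCoord, Finset.mem_filter, lowerEv]
  constructor
  · intro h
    by_cases he : e ∈ ω
    · refine Or.inr ⟨he, fun i hi => ?_⟩
      have := h i hi.1
      unfold orAndCoord at this
      rw [hi.2] at this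
      cases hG2 : G₂ i
      · rw [hG2] at this; simpa using this
      · rw [hG2] at this; simpa [he] using this
    · left
      have hall : ∀ i ∈ L, ω ∈ U i ∧ (G₁ i = true ∨ G₂ i = false) := fun i hi => by
        have := h i hi
        unfold orAndCoord at this
        cases hG1 : G₁ i <;> cases hG2 : G₂ i <;> rw [hG1] at this <;> simp_all
      rw [if_pos fun i hi => (hall i hi).2]
      exact Set.mem_iInter₂.2 fun i hi => (hall i hi).1
  · rintro (h | ⟨he, h⟩)
    · by_cases hL : ∀ i ∈ L, G₁ i = true ∨ G₂ i = false
      · rw [if_pos hL] at h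
        intro i hi
        have hω := Set.mem_iInter₂.1 h i hi
        unfold orAndCoord
        rcases hL i hi with hG | hG
        · rw [hG]; exact Or.inl hω
        · cases hG1 : G₁ i
          · rw [hG]; exact hω
          · exact Or.inl hω
      · rw [if_neg hL] at h; exact absurd h (Set.notMem_empty ω)
    · intro i hi
      unfold orAndCoord
      cases hG1 : G₁ i
      · cases hG2 : G₂ i
        · exact h i ⟨hi, hG1⟩
        · exact ⟨h i ⟨hi, hG1⟩, he⟩
      · exact Or.inr he

omit [Fintype ι] in
/-- The lower event is contained in the upper event. [this work] -/
theorem lowerEv_subset {n : ℕ} (U : Fin n → Set (Set ι)) (G₁ G₂ : Fin n → Bool) (L : Finset (Fin n)) :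
    lowerEv U G₁ G₂ L ⊆ ⋂ i ∈ L.filter (fun i => G₁ i = false), U i := by
  unfold lowerEv
  split_ifs
  · exact fun ω hω => Set.mem_iInter₂.2 fun i hi => Set.mem_iInter₂.1 hω i (Finset.mem_filter.1 hi).1
  · exact Set.empty_subset _

omit [Fintype ι] in
/-- Sections of `∅` are `∅`. [folklore] -/
theorem secAt_empty' (e : ι) (b : Bool) : secAt e b (∅ : Set (Set ι)) = ∅ := by
  ext ω; simp [mem_secAt]

omit [Fintype ι] in
/-- The lower event ignores `e` when the `U_j` do. [this work] -/
theorem secAt_lowerEv {n : ℕ} (U : Fin n → Set (Set ι)) (e : ι) (G₁ G₂ : Fin n → Bool) (hUe : ∀ (j : Fin n) (b : Bool), secAt e b (U j) = U j)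
    (L : Finset (Fin n)) (b : Bool) : secAt e b (lowerEv U G₁ G₂ L) = lowerEv U G₁ G₂ L := by
  unfold lowerEv
  split_ifs
  · exact secAt_biInter U e hUe L b
  · exact secAt_empty' e b

/-- The covariance "row" of two lower events is comb-positive at multidegree `2` off `e` (a hereditary row, or identically zero). [this work] -/
theorem combPos_cov_lowerEv (U : Fin 4 → Set (Set ι)) (e : ι) (G₁ G₂ : Fin 4 → Bool) (hUe : ∀ (j : Fin 4) (b : Bool), secAt e b (U j) = U j)
    (hU : CombHereditary U) (L L' : Finset (Fin 4)) :
    CombPos (update (fun _ : ι => 2) e 0) (fun p => ex (bernoulliWeight p) (ind (lowerEv U G₁ G₂ L) * ind (lowerEv U G₁ G₂ L'))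
      - ex (bernoulliWeight p) (ind (lowerEv U G₁ G₂ L)) * ex (bernoulliWeight p) (ind (lowerEv U G₁ G₂ L'))) := by
  have hz : ind (∅ : Set (Set ι)) = 0 := funext fun ω => ind_of_not_mem (Set.notMem_empty ω)
  unfold lowerEv
  split_ifs
  · refine (hU.row_off e hUe 2 ![L, L']).congr fun p => ?_
    rw [sahiE_two_apply]
    simp only [Matrix.cons_val_zero, Matrix.cons_val_one]
  · exact (CombPos.zero _).congr fun p => by simp [hz, SahiMixture.ex_zero_fun]
  · exact (CombPos.zero _).congr fun p => by simp [hz, SahiMixture.ex_zero_fun]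
  · exact (CombPos.zero _).congr fun p => by simp [hz, SahiMixture.ex_zero_fun]

/-! ### The cell interfaces -/

/-- **Interface: the sixteen-by-pattern three-slot cells of canonical type `k` for MIXED steps** — for every finite cube, every quadruple `U` of increasing events
ignoring `e` with `CombHereditary U`, and all selectors `G₁` (OR), `G₂` (AND): `p ↦ E_3(μ_p; (1_{⋂_{i ∈ canonK k j} orAndCoord U e G₁ G₂ i})_j)` is comb-positive at
multidegree `3`.  Pure patterns are theorems already; the mixed ones are to be lifted from the q = 1 certificates (gen 10). [this work] -/
def CombCanonThreeSlotMixedCells (k : Fin 4) : Prop :=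
  ∀ (ι : Type) [Fintype ι] (U : Fin 4 → Set (Set ι)) (e : ι), (∀ j, IsUpperSet (U j)) → (∀ (j : Fin 4) (b : Bool), secAt e b (U j) = U j) →
    CombHereditary U → ∀ (G₁ G₂ : Fin 4 → Bool),
      CombPos (fun _ : ι => 3) (fun p => sahiE (bernoulliWeight p) 3 (fun j => ind (⋂ i ∈ canonK k j, orAndCoord U e G₁ G₂ i)))

/-- **Interface: the singleton four-slot cells for MIXED steps** — `p ↦ E_4(μ_p; (1_{orAndCoord U e G₁ G₂ j})_j)` is comb-positive at multidegree `4`. [this work] -/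
def CombFourSingletonMixedCells : Prop :=
  ∀ (ι : Type) [Fintype ι] (U : Fin 4 → Set (Set ι)) (e : ι), (∀ j, IsUpperSet (U j)) → (∀ (j : Fin 4) (b : Bool), secAt e b (U j) = U j) →
    CombHereditary U → ∀ (G₁ G₂ : Fin 4 → Bool),
      CombPos (fun _ : ι => 4) (fun p => sahiE (bernoulliWeight p) 4 (fun j => ind (orAndCoord U e G₁ G₂ j)))

/-! ### Transport along permutations of events and slots -/

omit [Fintype ι] in
/-- Relabelling the events inside a member of the ∩-closed family of the mixed events. [this work] -/
theorem biInter_orAndCoord_image {n : ℕ} (U : Fin n → Set (Set ι)) (e : ι) (G₁ G₂ : Fin n → Bool) (π : Equiv.Perm (Fin n)) (L : Finset (Fin n)) :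
    (⋂ i ∈ L.image π, orAndCoord U e G₁ G₂ i) = ⋂ i ∈ L, orAndCoord (U ∘ π) e (G₁ ∘ π) (G₂ ∘ π) i := by
  rw [Finset.set_biInter_finset_image]
  rfl

/-- **Transport of a mixed three-slot cell**: if `K (τ j) = π(K' j)` then the cell of `(U, G₁, G₂)` over `K` is the cell of `(U ∘ π, G₁ ∘ π, G₂ ∘ π)` over `K'`. [this work] -/
theorem combPos_threeSlotMixed_transport (U : Fin 4 → Set (Set ι)) (e : ι) (G₁ G₂ : Fin 4 → Bool) (π : Equiv.Perm (Fin 4)) (τ : Equiv.Perm (Fin 3))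
    (K K' : Fin 3 → Finset (Fin 4)) (hK : ∀ j, K (τ j) = (K' j).image π)
    (h : CombPos (fun _ : ι => 3) (fun p => sahiE (bernoulliWeight p) 3 (fun j => ind (⋂ i ∈ K' j, orAndCoord (U ∘ π) e (G₁ ∘ π) (G₂ ∘ π) i)))) :
    CombPos (fun _ : ι => 3) (fun p => sahiE (bernoulliWeight p) 3 (fun j => ind (⋂ i ∈ K j, orAndCoord U e G₁ G₂ i))) := by
  refine h.congr fun p => ?_
  rw [← sahiE_comp_perm (bernoulliWeight p) 3 τ (fun j => ind (⋂ i ∈ K j, orAndCoord U e G₁ G₂ i))]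
  congr 1
  funext j
  show ind (⋂ i ∈ K (τ j), orAndCoord U e G₁ G₂ i) = ind (⋂ i ∈ K' j, orAndCoord (U ∘ π) e (G₁ ∘ π) (G₂ ∘ π) i)
  rw [hK j, biInter_orAndCoord_image]

/-- **Dispatcher**: the canonical mixed cells give every irredundant three-slot cell. [this work] -/
theorem combPos_threeSlotMixed_of_canon (hc : ∀ k, CombCanonThreeSlotMixedCells k) (U : Fin 4 → Set (Set ι)) (e : ι) (hUup : ∀ j, IsUpperSet (U j))
    (hUe : ∀ (j : Fin 4) (b : Bool), secAt e b (U j) = U j) (hU : CombHereditary U) (G₁ G₂ : Fin 4 → Bool) (K : Fin 3 → Finset (Fin 4))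
    (hK : Irredundant K) :
    CombPos (fun _ : ι => 3) (fun p => sahiE (bernoulliWeight p) 3 (fun j => ind (⋂ i ∈ K j, orAndCoord U e G₁ G₂ i))) := by
  obtain ⟨π, τ, k, hKc⟩ := hK.canon_three_four
  exact combPos_threeSlotMixed_transport U e G₁ G₂ π τ K (canonK k) hKc
    (hc k ι (U ∘ π) e (fun j => hUup (π j)) (fun j b => hUe (π j) b) (hU.reindex π) (G₁ ∘ π) (G₂ ∘ π))

/-! ### The assembly -/

/-- **MIXED STEP OVER FOUR EVENTS FROM ITS CELLS.**  Given the two interfaces: for every finite cube, every quadruple `U` of increasing events ignoring `e` with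
`CombHereditary U`, and all selectors, `orAndCoord U e G₁ G₂` is `CombHereditary`. [this work] -/
theorem combHereditary_orAndCoord_four_of_cells (hc : ∀ k, CombCanonThreeSlotMixedCells k) (h4 : CombFourSingletonMixedCells) (U : Fin 4 → Set (Set ι)) (e : ι)
    (G₁ G₂ : Fin 4 → Bool) (hUup : ∀ j, IsUpperSet (U j)) (hUe : ∀ (j : Fin 4) (b : Bool), secAt e b (U j) = U j) (hU : CombHereditary U) :
    CombHereditary (orAndCoord U e G₁ G₂) := by
  refine SahiCombHereditary.combHereditary_of_irredundant _ fun m K hK => ?_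
  have hm : m ≤ 4 := hK.card_le
  have hsecL : ∀ (L : Finset (Fin 4)) (b : Bool), secAt e b (lowerEv U G₁ G₂ L) = lowerEv U G₁ G₂ L := secAt_lowerEv U e G₁ G₂ hUe
  have hsecQ : ∀ (L : Finset (Fin 4)) (b : Bool), secAt e b (⋂ i ∈ L.filter (fun i => G₁ i = false), U i) = ⋂ i ∈ L.filter (fun i => G₁ i = false), U i :=
    fun L b => secAt_biInter U e hUe _ b
  have hcovQ : ∀ L L' : Finset (Fin 4), CombPos (update (fun _ : ι => 2) e 0)
      (fun p => ex (bernoulliWeight p) (ind (⋂ i ∈ L, U i) * ind (⋂ i ∈ L', U i))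
        - ex (bernoulliWeight p) (ind (⋂ i ∈ L, U i)) * ex (bernoulliWeight p) (ind (⋂ i ∈ L', U i))) := by
    intro L L'
    refine (hU.row_off e hUe 2 ![L, L']).congr fun p => ?_
    rw [sahiE_two_apply]
    simp only [Matrix.cons_val_zero, Matrix.cons_val_one]
  interval_cases m
  · exact (CombPos.zero _).congr fun _ => sahiE_zero _ _
  · exact (combPos_ex_ind _).congr fun _ => sahiE_one_apply _ _
  · have eK : (fun j => ind (⋂ i ∈ K j, orAndCoord U e G₁ G₂ i)) =
        ![ind (mixCoord e (lowerEv U G₁ G₂ (K 0)) (⋂ i ∈ (K 0).filter (fun i => G₁ i = false), U i)),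
          ind (mixCoord e (lowerEv U G₁ G₂ (K 1)) (⋂ i ∈ (K 1).filter (fun i => G₁ i = false), U i))] := by
      funext j; fin_cases j <;> simp [biInter_orAndCoord_eq_mixCoord]
    rw [show (fun p => sahiE (bernoulliWeight p) 2 (fun j => ind (⋂ i ∈ K j, orAndCoord U e G₁ G₂ i)))
        = fun p => sahiE (bernoulliWeight p) 2 ![ind (mixCoord e (lowerEv U G₁ G₂ (K 0)) (⋂ i ∈ (K 0).filter (fun i => G₁ i = false), U i)),
          ind (mixCoord e (lowerEv U G₁ G₂ (K 1)) (⋂ i ∈ (K 1).filter (fun i => G₁ i = false), U i))] from by rw [eK]]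
    exact combPos_two_mixCoord e (hsecL _) (hsecQ _) (hsecL _) (hsecQ _) (lowerEv_subset U G₁ G₂ _) (lowerEv_subset U G₁ G₂ _)
      (combPos_cov_lowerEv U e G₁ G₂ hUe hU _ _) (hcovQ _ _)
  · exact combPos_threeSlotMixed_of_canon hc U e hUup hUe hU G₁ G₂ K hK
  · obtain ⟨σ, hσ⟩ := SahiCombHereditary.exists_perm_of_irredundant hK
    have eK : (fun j => ind (⋂ i ∈ K j, orAndCoord U e G₁ G₂ i)) = fun j => (fun i => ind (orAndCoord U e G₁ G₂ i)) (σ j) := by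
      funext j; rw [hσ j, Finset.set_biInter_singleton]
    refine (h4 ι U e hUup hUe hU G₁ G₂).congr fun p => ?_
    rw [eK, sahiE_comp_perm (bernoulliWeight p) 4 σ (fun i => ind (orAndCoord U e G₁ G₂ i))]

/-! ### Corollaries modulo the cells: grown quadruples and decision lists -/

/-- **GROWING FOUR EVENTS BY MIXED STEPS (modulo the cells).** [this work] -/
theorem combHereditary_grow₂_four_of_cells (hc : ∀ k, CombCanonThreeSlotMixedCells k) (h4 : CombFourSingletonMixedCells) {U : Fin 4 → Set (Set ι)}
    (hUup : ∀ j, IsUpperSet (U j)) {S : Set ι} (hUS : ∀ j, DeterminedBy (U j) S) (hU : CombHereditary U) :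
    ∀ (L : List (ι × (Fin 4 → Bool) × (Fin 4 → Bool))), (L.map Prod.fst).Nodup → (∀ s ∈ L, s.1 ∉ S) → CombHereditary (grow₂ U L)
  | [], _, _ => hU
  | s :: L, hL, hS => by
    rw [List.map_cons, List.nodup_cons] at hL
    have ih := combHereditary_grow₂_four_of_cells hc h4 hUup hUS hU L hL.2 fun t ht => hS t (List.mem_cons_of_mem s ht)
    have hup := isUpperSet_grow₂ hUup L
    have hig : ∀ (j : Fin 4) (b : Bool), secAt s.1 b (grow₂ U L j) = grow₂ U L j := fun j b =>
      SahiCombJunta.secAt_eq_self_of_determinedBy (determinedBy_grow₂ hUS L j) (by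
        simp only [Set.mem_union, Set.mem_setOf_eq, not_or]
        exact ⟨hS s List.mem_cons_self, hL.1⟩) b
    exact combHereditary_orAndCoord_four_of_cells hc h4 _ s.1 s.2.1 s.2.2 hup hig ih

/-- **EVERY QUADRUPLE OF COMMON-ORDER MONOTONE DECISION LISTS IS HEREDITARILY COMB-POSITIVE — modulo the two cell interfaces.** [this work] -/
theorem combHereditary_decisionList_four_of_cells (hc : ∀ k, CombCanonThreeSlotMixedCells k) (h4 : CombFourSingletonMixedCells) (c : Fin 4 → Bool)
    (L : List (ι × (Fin 4 → Bool) × (Fin 4 → Bool))) (hL : (L.map Prod.fst).Nodup) :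
    CombHereditary (grow₂ (fun j => bif c j then (Set.univ : Set (Set ι)) else ∅) L) := by
  refine combHereditary_grow₂_four_of_cells hc h4 (S := (∅ : Set ι)) (fun j => ?_) (fun j => ?_) (SahiCombHereditary.combHereditary_constFamily c) L hL
    (fun s _ => Set.notMem_empty _)
  · cases c j
    · exact isUpperSet_empty
    · exact isUpperSet_univ
  · cases c j
    · rw [determinedBy_iff]; intro ω ω' _; simp
    · exact determinedBy_univ _

end SahiCombMix

end Summit.CriticalPhenomena.PercolationContinuityZ3.Theorems

end
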